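import Summits.Ventures.HodgeRepro2.T6A2WeilAssembly
import Summits.Ventures.HodgeRepro2.T6NDatum

/-!
# T6A2WeilHostDatum — the M2 period datum over the HOST shadow (`shadowOf`, W14) and the lead's row condition `htie`

Cell pub-hodge-repro2, Tier 6 (README §10), seat t6-p2 (A2 owner; gen 7). Built to the lead's M2-final spec
(STATUS l. 12079 (3)): the row condition of `hccm_of_published_M2` is
`htie : ∀ Bd hB K [..] C (c : (P Bd hB K C).Choice), (P Bd hB K C).AdmChoice c →
  ∃ (S : SPVar ℂ) (hS : S.n = 2) (f : S.X ⟶ C.B.X), (P Bd hB K C).shadow c = shadowOf coeffC Bd hnat hB C h17 hD hLefD hT21 S hS f hProd hPt`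
(«a datum whose `shadow` field IS `shadowOf` discharges it by `rfl`»). This file is that datum, generically:
* `SurfaceDatum C` — a surface datum of the corner product (`S` smooth projective of dimension 2, `f : S → B`);
* `NDatum.ofHostShadow` — the M2 period datum (TARGET-T6 §9.2(a)) whose Layer-III datum at a choice `c` is the host
  shadow `shadowOf …` of the surface datum `surf c`; the choice type, its admissibility, the base embedding `τ₁` and
  the eigenline generators `e` / `e_mem` are PARAMETERS (the N side's objects: TIER5 (N0.1)(b), (N0.2)(q3)–(q5));
* `NDatum.ofHostShadow_shadow` (the `shadow` field, by `rfl`) and `htie_ofHostShadow` — the row condition holds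
  for every choice, with the witness `surf c`;
* `periodN_ofHostShadow_of_I_ne_zero` — the displayed (N) on the host shadow from `I_{σ}(D_c) ≠ 0` (N0.2), and
  `splitWeilAlgebraic_ofHostShadow` — Theorem A on the host for the corner product from `Hyp.PeriodN` of the datum's
  shadow at any choice (`splitWeilAlgebraic_of_A2` at `surf c`).
Nothing about the automorphic side is asserted; no display is introduced. No `sorry`; standard axioms.
§8(d): uses an L-value-free non-vanishing device: NO.
Filed in the Tier-6 M2-final (2026-08-26) as p416673 (definition lane, ACCEPTED 01:46:40Z, gate sha256 180c6fab422cd107…); this v2 differs from the filed bytes in this module docstring only (the status word «STAGED» replaced by «Built to»; the v1 bytes stay the banded bytes of record).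
-/

noncomputable section

namespace Summit.Ventures.HodgeRepro2.T6.WeilAssembly

open CategoryTheory
open HostAPI.Carriers.AlgebraicGeometry.Motives HostAPI.Carriers.AlgebraicGeometry.HodgeTheory
open Summit.Ventures.HodgeRepro2.T6 Host WeilInst A1HostBetti

variable {K : Type} [Field K] [NumberField K] [NumberField.IsCMField K]

/-- A SURFACE DATUM of the corner product: a smooth projective surface `S` over `ℂ` with a morphism into the
corner product's abelian variety (TIER4 §D: `S = X_K`, `f = (f_i)`). -/
structure SurfaceDatum (C : CornerProduct K) where
  /-- the surface -/
  S : SPVar ℂ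
  /-- of dimension 2 -/
  hS : S.n = 2
  /-- the morphism to `B` -/
  f : S.X ⟶ C.B.X

variable (coeffC : ∀ (X : SchemeOver ℂ) (k : ℕ), HC X k →ₗ[ℂ] H X k) (Bd : BettiHodgeData ℂ)
  (hnat : CoeffNatural coeffC) (hB : BettiClauses coeffC Bd) (C : CornerProduct K) (h17 : Lemma1117Q)
  (hD : Hyp.LangeBirkenhake1992_Prop1_1_20 Bd) (hLefD : Hyp.Lefschetz11_Betti Bd)
  (hT21 : Hyp.LangeBirkenhake1992_Thm1_1_21_Betti Bd)
  (hProd : Hyp.Hartshorne1977_productProjective) (hPt : Hyp.Hartshorne1977_pointProjective)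

/-- the host shadow of a surface datum -/
abbrev shadowOfSurface (d : SurfaceDatum C) : TransferShadow C.F :=
  shadowOf coeffC Bd hnat hB C h17 hD hLefD hT21 d.S d.hS d.f hProd hPt

/-- **THE M2 PERIOD DATUM OVER THE HOST SHADOW** (TARGET-T6 §9.2(a)): choices `Choice` with admissibility `Adm`,
a surface datum `surf c` per choice, the Layer-III datum `shadowOf …` of that surface datum, the base embedding
`τ₁` and the eigenline generators `e`. -/
def _root_.Summit.Ventures.HodgeRepro2.T6.NDatum.ofHostShadow (Choice : Type) (Adm : Choice → Prop)
    (surf : Choice → SurfaceDatum C) (τ₁ : K →+* ℂ) (e : (K →+* ℂ) → Fin 4 → H1C K)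
    (e_mem : ∀ σ i, e σ i ∈ eigenLine K i σ) : NDatum C.F where
  Choice := Choice
  AdmChoice := Adm
  shadow c := shadowOfSurface coeffC Bd hnat hB C h17 hD hLefD hT21 hProd hPt (surf c)
  τ₁ := τ₁
  e := e
  e_mem := e_mem

/-- the `shadow` field of `NDatum.ofHostShadow`, by `rfl` -/
theorem _root_.Summit.Ventures.HodgeRepro2.T6.NDatum.ofHostShadow_shadow (Choice : Type) (Adm : Choice → Prop)
    (surf : Choice → SurfaceDatum C) (τ₁ : K →+* ℂ) (e : (K →+* ℂ) → Fin 4 → H1C K)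
    (e_mem : ∀ σ i, e σ i ∈ eigenLine K i σ) (c : Choice) :
    (NDatum.ofHostShadow coeffC Bd hnat hB C h17 hD hLefD hT21 hProd hPt Choice Adm surf τ₁ e e_mem).shadow c =
      shadowOf coeffC Bd hnat hB C h17 hD hLefD hT21 (surf c).S (surf c).hS (surf c).f hProd hPt :=
  rfl

/-- **THE LEAD'S ROW CONDITION `htie` HOLDS FOR THE HOST-SHADOW DATUM** (STATUS l. 12079 (3)(b)): at every
choice, the datum's shadow is `shadowOf …` of a surface datum — the witness is `surf c`. -/
theorem htie_ofHostShadow (Choice : Type) (Adm : Choice → Prop) (surf : Choice → SurfaceDatum C)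
    (τ₁ : K →+* ℂ) (e : (K →+* ℂ) → Fin 4 → H1C K) (e_mem : ∀ σ i, e σ i ∈ eigenLine K i σ) :
    ∀ c : Choice, Adm c → ∃ (S : SPVar ℂ) (hS : S.n = 2) (f : S.X ⟶ C.B.X),
      (NDatum.ofHostShadow coeffC Bd hnat hB C h17 hD hLefD hT21 hProd hPt Choice Adm surf τ₁ e e_mem).shadow c =
        shadowOf coeffC Bd hnat hB C h17 hD hLefD hT21 S hS f hProd hPt :=
  fun c _ => ⟨(surf c).S, (surf c).hS, (surf c).f, rfl⟩

/-- the displayed (N) on the host shadow of `surf c` from the quadruple period `I_σ(D_c) ≠ 0` (TIER5 (N0.2)) -/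
theorem periodN_ofHostShadow_of_I_ne_zero (Choice : Type) (Adm : Choice → Prop) (surf : Choice → SurfaceDatum C)
    (τ₁ : K →+* ℂ) (e : (K →+* ℂ) → Fin 4 → H1C K) (e_mem : ∀ σ i, e σ i ∈ eigenLine K i σ) {σ : K →+* ℂ}
    {c : Choice}
    (h : (NDatum.ofHostShadow coeffC Bd hnat hB C h17 hD hLefD hT21 hProd hPt Choice Adm surf τ₁ e e_mem).I σ c ≠ 0) :
    Hyp.PeriodN (shadowOf coeffC Bd hnat hB C h17 hD hLefD hT21 (surf c).S (surf c).hS (surf c).f hProd hPt) :=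
  (NDatum.ofHostShadow coeffC Bd hnat hB C h17 hD hLefD hT21 hProd hPt Choice Adm surf τ₁ e e_mem).periodN_of_I_ne_zero h

/-- **THEOREM A ON THE HOST FROM THE DATUM**: `Hyp.PeriodN` of the host-shadow datum's shadow at any choice gives
`SplitWeilAlgebraic C` (`splitWeilAlgebraic_of_A2` at the surface datum `surf c`). -/
theorem splitWeilAlgebraic_ofHostShadow [IsGalois ℚ K] (Choice : Type) (Adm : Choice → Prop)
    (surf : Choice → SurfaceDatum C) (τ₁ : K →+* ℂ) (e : (K →+* ℂ) → Fin 4 → H1C K)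
    (e_mem : ∀ σ i, e σ i ∈ eigenLine K i σ) (c : Choice)
    (hN : Hyp.PeriodN
      ((NDatum.ofHostShadow coeffC Bd hnat hB C h17 hD hLefD hT21 hProd hPt Choice Adm surf τ₁ e e_mem).shadow c)) :
    SplitWeilAlgebraic C :=
  splitWeilAlgebraic_of_A2 coeffC Bd hnat hB C h17 hD hLefD hT21 (surf c).S (surf c).hS (surf c).f hProd hPt hN

end Summit.Ventures.HodgeRepro2.T6.WeilAssembly

end
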